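import Summits.CriticalPhenomena.PercolationContinuityZ3.Theses.PercMinContact
import Summits.CriticalPhenomena.PercolationContinuityZ3.Theorems.PercMinContactTwoArmWindowSmallLevel
import Summits.CriticalPhenomena.PercolationContinuityZ3.Theorems.PercMinContactTwoArmWindowHalf
import Summits.CriticalPhenomena.PercolationContinuityZ3.Theorems.PercMinContactTwoArmWindowClauseAHalf
import Summits.CriticalPhenomena.PercolationContinuityZ3.Theorems.PercMinContactTwoArmWindowVolumeTailMono
import Summits.CriticalPhenomena.PercolationContinuityZ3.Theorems.PercMinContactTwoArmWindowSubcritVolumeTail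
import Summits.CriticalPhenomena.PercolationContinuityZ3.Theorems.PercMinContactTwoArmWindowBudget

/-!
# `Lines/birth.lean` (rev 4b) — skeleton for crux `PercMinContact.TwoArmWindow`
(item stmt-CriticalPhenomena-11499 · route route-CriticalPhenomena-PercMinContact · sub-problem
`PercolationContinuityZ3` · line slug `registered` · lead prover-line-stmt-CriticalPhenomena-11499-c3-0,
2026-08-17; rev 1 = the planner's birth skeleton, sha 25c95290…; rev 2 = lead c1's level split of
engine (a); rev 3b = lead c2, sha 92b1a96f…, stubs `stub_volumeTwoArmCore` + `stub_gapWindow`)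

**Rev 4 (lead c3, cycle 3) = rev 3b with engine (b) split BY LEVEL into its KNOWN deep-subcritical
piece and the OPEN near-critical core — the exact analogue for (b) of what rev 2 did for (a).**
Statements of `stub_volumeTwoArmCore` and of the derived `stub_gapWindow` are byte-identical to rev 3b.

* `stub_gapWindowNear` — OPEN core of engine (b): the volume window with gap exponent `Δ₀ < 5/2`
  on the levels `p_c − ε₀ < u < p_c` only (some `ε₀ > 0`).  This is where the open problem lives:
  ANY polynomial subcritical window on `ℤ³` is beyond print (frontier: `ξ_p ≤ exp(C/(p_c−p)²)`,
  Duminil-Copin–Kozma–Tassion arXiv:1902.03207 Thm 2, PROVED in the tree as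
  `DuminilcopinKozmaTassion2020_thm2_subcritical_holds`; literature re-checked 2026-08-17, no change).
* `stub_subcritVolumeTail` — KNOWN (Kesten 1981; Aizenman–Newman 1984 §5; Grimmett 1999 Thm (6.75)):
  at every FIXED level `u < p_c` the cluster volume has an exponential tail,
  `P_u(|C(0)| ≥ n) ≤ C(u)·exp(−c(u)·n)`.  Not yet in the tree; provable from in-tree material by
  Kesten's block argument: `perc_sharpness_holds` (radius decay at level `u`) makes the block event
  "some vertex of the `N`-block is joined to sup-distance `N`" rare, the met-block set of a cluster of
  volume `≥ n > (2N)³` is a `★`-connected animal of `≥ n/N³` bad blocks, and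
  `KestenZhangPeierls.measureReal_exists_starAnimal_bad_le` (finitely dependent Peierls) sums it.
* `stub_volumeTail_mono` — KNOWN glue (monotone coupling, `prodBernoulli_real_mono_of_isUpperSet`):
  `u ≤ v ⇒ P_u(|C(0)| ≥ n) ≤ P_v(|C(0)| ≥ n)`.
* `gapWindow_of` — composition of the three into the rev-3b statement `Sig.stub_gapWindow`, sorry-free:
  at levels `u ≤ u₀ := max(p_c − ε₀/2, 0)` monotonicity + the tail at `u₀` give
  `P_u ≤ C₀ e^{−c₀ n} ≤ C₀ e^{−c₀ n s^{Δ₀}}` (`s = p_c − u ∈ (0,1]`, so `s^{Δ₀} ≤ 1`); above `u₀` the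
  near stub applies; constants `C' = max(C, C₀, 0)`, `c' = min(c, c₀)`.
* `stub_volumeTwoArmCore` — OPEN core of engine (a), unchanged (λ ≥ 3/5 on `1/5 < u < p_c`; known
  λ = 1/2, landed p145214/p146583).
* budget records (LANDED p150861): `gapWindowNear_gap_ge_one` (any near window has `Δ₀ ≥ 1`) and
  `gapWindowNear_lt_two_summit` (`Δ₀ < 2` ⇒ summit), §3.
* `TwoArmWindow_of` — THE SKELETON: the registered open stubs ⇒ crux BY NAME (rev 4a: the landed
  `stub_volumeTail_mono`, p149565, is used inside, no longer a hypothesis;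
  `twoArmWindow_body_of_engines`, the unchanged rev-3b composition of the two engines, and
  an `example` of its crux-by-name form).

**Crux.** `TwoArmWindow`: `∃ λ ∈ [0,1), Δ₀ > 0` with `Δ₀(1 − λ) < 1` and constants `C`, `c > 0` such
that for every level `u < p_c(ℤ³)` (`u : unitInterval`)
(a) `Σ_{y ∼ 0} P_u(|C(0)| ≥ n, |C(y)| ≥ n, 0 ↮ y) ≤ C · n^{−λ}` for all `n ≥ 1` (p-UNIFORM VOLUME
TWO-ARM bound), and (b) `P_u(|C(0)| ≥ n) ≤ C · exp(−c · n · (p_c − u)^{Δ₀})` for all `n`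
(SUBCRITICAL VOLUME WINDOW).  Budget allocation kept from rev 1: `λ ≥ 3/5`, `Δ₀ < 5/2`
(`(1 − 3/5)(5/2) = 1`, strictness on `Δ₀`).

Disproof / negatives honoured: `Cruxes/TwoArmWindow/` has no `Disproof.lean` and no
`_false_without_` theorem (checked 2026-08-17T07:50Z, `ledger crux ls`); refuters' corner analysis
(`λ = 0` excluded by `λ ≥ 3/5`; `n = 0, 1` corners of (b) absorbed in `C`; `Δ₀ ≥ 4/3` forced by
Hutchcroft 2022 Thm 1.3 + `δ ≥ 2`) is consistent with the allocation.

Layout: §0 name-keyed `Prop`s `Sig.stub_*` · §1 the registered stubs (`stub_twoArmSmallLevel` closed by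
the landed theorem; the two OPEN cores and the two KNOWN (b)-pieces are the only `sorry`s) · §2 the
compositions `gapWindow_of`, `twoArmWindow_body_of_engines`, `TwoArmWindow_of`
(kernel-checked, no `sorry` of their own) · §3 definitional consistency and the landed `λ = 1/2` records.
-/

namespace Summit.CriticalPhenomena.PercolationContinuityZ3.Cruxes.TwoArmWindow.Birth

open Literature.Probability.Percolation Literature.Probability.LatticeModels

/-! ## §0 The stub statements, name-keyed -/

namespace Sig

/-- Name-keyed statement of `stub_twoArmSmallLevel` (engine (a), levels `u ≤ 1/5`, exponent `1`).
[stub statement; known — path counting below `1/(2d−1)`; LANDED p146056] -/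
def stub_twoArmSmallLevel : Prop :=
  ∃ C : ℝ, ∀ u : unitInterval, (u : ℝ) ≤ 1 / 5 → ∀ n : ℕ, 1 ≤ n →
    ∑ y ∈ (zdGraph 3).neighborFinset (0 : Site 3),
      (bondPercolation (zdGraph 3) u).real
        {ω | (n : ℕ∞) ≤ (openCluster ω 0).encard ∧ (n : ℕ∞) ≤ (openCluster ω y).encard ∧
          ¬ (openGraph ω).Reachable 0 y} ≤ C * (n : ℝ) ^ (-(1 : ℝ))

/-- Name-keyed statement of `stub_volumeTwoArmCore` (engine (a), levels `1/5 < u < p_c`, `λ ≥ 3/5`).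
[stub statement; open problem] -/
def stub_volumeTwoArmCore : Prop :=
  ∃ lam C : ℝ, 3 / 5 ≤ lam ∧ lam < 1 ∧
    ∀ u : unitInterval, 1 / 5 < (u : ℝ) → (u : ℝ) < criticalProb (zdGraph 3) 0 → ∀ n : ℕ, 1 ≤ n →
      ∑ y ∈ (zdGraph 3).neighborFinset (0 : Site 3),
        (bondPercolation (zdGraph 3) u).real
          {ω | (n : ℕ∞) ≤ (openCluster ω 0).encard ∧ (n : ℕ∞) ≤ (openCluster ω y).encard ∧
            ¬ (openGraph ω).Reachable 0 y} ≤ C * (n : ℝ) ^ (-lam)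

/-- Name-keyed statement of the rev-3b stub `stub_gapWindow` (engine (b), `Δ₀ < 5/2`), now DERIVED
from the three (b)-stubs below by `gapWindow_of`. [derived statement; open problem] -/
def stub_gapWindow : Prop :=
  ∃ Δ₀ C c : ℝ, 0 < Δ₀ ∧ Δ₀ < 5 / 2 ∧ 0 < c ∧
    ∀ u : unitInterval, (u : ℝ) < criticalProb (zdGraph 3) 0 → ∀ n : ℕ,
      (bondPercolation (zdGraph 3) u).real {ω | (n : ℕ∞) ≤ (openCluster ω 0).encard} ≤
        C * Real.exp (-(c * n * (criticalProb (zdGraph 3) 0 - u) ^ Δ₀))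

/-- Name-keyed statement of `stub_gapWindowNear` (engine (b), near-critical levels only).
[stub statement; open problem] -/
def stub_gapWindowNear : Prop :=
  ∃ Δ₀ C c ε₀ : ℝ, 0 < Δ₀ ∧ Δ₀ < 5 / 2 ∧ 0 < c ∧ 0 < ε₀ ∧
    ∀ u : unitInterval, criticalProb (zdGraph 3) 0 - ε₀ < (u : ℝ) →
      (u : ℝ) < criticalProb (zdGraph 3) 0 → ∀ n : ℕ,
        (bondPercolation (zdGraph 3) u).real {ω | (n : ℕ∞) ≤ (openCluster ω 0).encard} ≤
          C * Real.exp (-(c * n * (criticalProb (zdGraph 3) 0 - u) ^ Δ₀))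

/-- Name-keyed statement of `stub_subcritVolumeTail` (exponential volume tail at a fixed subcritical
level). [stub statement; known — Kesten 1981 / Aizenman–Newman 1984 / Grimmett 1999 Thm (6.75)] -/
def stub_subcritVolumeTail : Prop :=
  ∀ u : unitInterval, (u : ℝ) < criticalProb (zdGraph 3) 0 → ∃ C c : ℝ, 0 < c ∧ ∀ n : ℕ,
    (bondPercolation (zdGraph 3) u).real {ω | (n : ℕ∞) ≤ (openCluster ω 0).encard} ≤
      C * Real.exp (-(c * n))

/-- Name-keyed statement of `stub_volumeTail_mono` (monotone coupling for the increasing event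
`{|C(0)| ≥ n}`). [stub statement; known — folklore] -/
def stub_volumeTail_mono : Prop :=
  ∀ u v : unitInterval, u ≤ v → ∀ n : ℕ,
    (bondPercolation (zdGraph 3) u).real {ω | (n : ℕ∞) ≤ (openCluster ω 0).encard} ≤
      (bondPercolation (zdGraph 3) v).real {ω | (n : ℕ∞) ≤ (openCluster ω 0).encard}

end Sig

/-! ## §1 Registered stubs -/

/-- **Stub (a₀) — SMALL LEVELS, KNOWN and LANDED (p146056).**  There is `C` such that for every level
`u ≤ 1/5` and every `n ≥ 1`, `Σ_{y ∼ 0} P_u(|C(0)| ≥ n ∧ |C(y)| ≥ n ∧ 0 ↮ y) ≤ C · n^{−1}`.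
Proof = the landed theorem `Theorems.stub_twoArmSmallLevel`. -/
theorem stub_twoArmSmallLevel :
    ∃ C : ℝ, ∀ u : unitInterval, (u : ℝ) ≤ 1 / 5 → ∀ n : ℕ, 1 ≤ n →
      ∑ y ∈ (zdGraph 3).neighborFinset (0 : Site 3),
        (bondPercolation (zdGraph 3) u).real
          {ω | (n : ℕ∞) ≤ (openCluster ω 0).encard ∧ (n : ℕ∞) ≤ (openCluster ω y).encard ∧
            ¬ (openGraph ω).Reachable 0 y} ≤ C * (n : ℝ) ^ (-(1 : ℝ)) :=
  Summit.CriticalPhenomena.PercolationContinuityZ3.Theorems.stub_twoArmSmallLevel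

/-- **Stub (a) core — p-uniform VOLUME TWO-ARM exponent `λ ≥ 3/5` on `1/5 < u < p_c`, OPEN.**
There are `λ ∈ [3/5, 1)` and `C` such that for every level `1/5 < u < p_c(ℤ³)` and every `n ≥ 1`,
`Σ_{y ∼ 0} P_u(|C(0)| ≥ n ∧ |C(y)| ≥ n ∧ 0 ↮ y) ≤ C · n^{−λ}`.  Known on this range: `λ = 1/2`
(two-ghost inequality, arXiv:1808.08940 Cor. 1.7, PROVED in the tree as
`Hutchcroft2020_twoGhost_corollary_holds`; landed as `Theorems.twoArm_half`); predicted `λ_c ≈ 0.737`. -/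
theorem stub_volumeTwoArmCore :
    ∃ lam C : ℝ, 3 / 5 ≤ lam ∧ lam < 1 ∧
      ∀ u : unitInterval, 1 / 5 < (u : ℝ) → (u : ℝ) < criticalProb (zdGraph 3) 0 → ∀ n : ℕ, 1 ≤ n →
        ∑ y ∈ (zdGraph 3).neighborFinset (0 : Site 3),
          (bondPercolation (zdGraph 3) u).real
            {ω | (n : ℕ∞) ≤ (openCluster ω 0).encard ∧ (n : ℕ∞) ≤ (openCluster ω y).encard ∧
              ¬ (openGraph ω).Reachable 0 y} ≤ C * (n : ℝ) ^ (-lam) := by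
  sorry

/-- **Stub (b) core — NEAR-CRITICAL VOLUME WINDOW with gap exponent `Δ₀ < 5/2`, OPEN.**  There are
`Δ₀ ∈ (0, 5/2)`, `C`, `c > 0` and `ε₀ > 0` such that for every level `p_c − ε₀ < u < p_c(ℤ³)` and
every `n`, `P_u(|C(0)| ≥ n) ≤ C · exp(−c · n · (p_c − u)^{Δ₀})`.  Truth `Δ = 1/σ ≈ 2.21`
(`d = 3`); rigorous today only `ξ_p ≤ exp(C/(p_c − p)²)` (arXiv:1902.03207 Thm 2, PROVED in the tree). -/
theorem stub_gapWindowNear :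
    ∃ Δ₀ C c ε₀ : ℝ, 0 < Δ₀ ∧ Δ₀ < 5 / 2 ∧ 0 < c ∧ 0 < ε₀ ∧
      ∀ u : unitInterval, criticalProb (zdGraph 3) 0 - ε₀ < (u : ℝ) →
        (u : ℝ) < criticalProb (zdGraph 3) 0 → ∀ n : ℕ,
          (bondPercolation (zdGraph 3) u).real {ω | (n : ℕ∞) ≤ (openCluster ω 0).encard} ≤
            C * Real.exp (-(c * n * (criticalProb (zdGraph 3) 0 - u) ^ Δ₀)) := by
  sorry

/-- **Stub (b₁) — EXPONENTIAL VOLUME TAIL AT A FIXED SUBCRITICAL LEVEL, KNOWN and LANDED (p151244)**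
(Kesten 1981; Aizenman–Newman 1984 §5; Grimmett 1999 Thm (6.75)): for every level `u < p_c(ℤ³)` there
are `C` and `c > 0` with `P_u(|C(0)| ≥ n) ≤ C · exp(−c · n)` for all `n`.  Proof = the landed theorem
`Theorems.stub_subcritVolumeTail` (`Theorems/PercMinContactTwoArmWindowSubcritVolumeTail.lean`, the
case `d = 3` of `TwoArmWindowSubcritVolumeTail.subcritical_volumeTail`, Kesten's block argument on the
in-tree sharpness `perc_sharpness_holds` and the Kesten–Zhang finitely-dependent Peierls estimate;
helper file `…SubcritVolumeTailBlocks.lean`, p150832). -/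
theorem stub_subcritVolumeTail :
    ∀ u : unitInterval, (u : ℝ) < criticalProb (zdGraph 3) 0 → ∃ C c : ℝ, 0 < c ∧ ∀ n : ℕ,
      (bondPercolation (zdGraph 3) u).real {ω | (n : ℕ∞) ≤ (openCluster ω 0).encard} ≤
        C * Real.exp (-(c * n)) :=
  Summit.CriticalPhenomena.PercolationContinuityZ3.Theorems.stub_subcritVolumeTail

/-- **Stub (b₂) — MONOTONICITY OF THE VOLUME TAIL IN THE LEVEL, KNOWN and LANDED (p149565)**
(increasing event `clusterSizeGe 0 n`, monotone coupling `DCT16.real_mono_of_isUpperSet`):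
`u ≤ v ⇒ P_u(|C(0)| ≥ n) ≤ P_v(|C(0)| ≥ n)`.  Proof = the landed theorem `Theorems.stub_volumeTail_mono`
(`Theorems/PercMinContactTwoArmWindowVolumeTailMono.lean`). -/
theorem stub_volumeTail_mono :
    ∀ u v : unitInterval, u ≤ v → ∀ n : ℕ,
      (bondPercolation (zdGraph 3) u).real {ω | (n : ℕ∞) ≤ (openCluster ω 0).encard} ≤
        (bondPercolation (zdGraph 3) v).real {ω | (n : ℕ∞) ≤ (openCluster ω 0).encard} :=
  Summit.CriticalPhenomena.PercolationContinuityZ3.Theorems.stub_volumeTail_mono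

/-! ## §2 Compositions (kernel-checked, no `sorry` of their own) -/

/-- **Engine (b) from its three pieces.**  The near-critical window (`stub_gapWindowNear`), the
exponential tail at the single level `u₀ = max(p_c − ε₀/2, 0)` (`stub_subcritVolumeTail`) and
monotonicity below `u₀` (`stub_volumeTail_mono`) give the rev-3b window `Sig.stub_gapWindow` on all
of `u < p_c`, with the same `Δ₀` and constants `max(C, C₀, 0)`, `min(c, c₀)`; `0 < p_c < 1` is
`Grimmett1999_criticalProb_pos_lt_one_holds`. -/
theorem gapWindow_of (hN : Sig.stub_gapWindowNear) (hT : Sig.stub_subcritVolumeTail)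
    (hM : Sig.stub_volumeTail_mono) : Sig.stub_gapWindow := by
  obtain ⟨Δ₀, C, c, ε₀, hΔ₀, hΔ₁, hc, hε₀, hN⟩ := hN
  have hpc := Grimmett1999_criticalProb_pos_lt_one_holds 3 (by norm_num)
  set pc : ℝ := criticalProb (zdGraph 3) (0 : Site 3) with hpc_def
  -- the anchor level `u₀ = max (pc - ε₀/2) 0 ∈ [0, pc)`
  set t : ℝ := max (pc - ε₀ / 2) 0 with ht_def
  have ht0 : 0 ≤ t := le_max_right _ _
  have htpc : t < pc := max_lt (by linarith) hpc.1
  have ht1 : t ≤ 1 := (htpc.trans hpc.2).le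
  set u₀ : unitInterval := ⟨t, ht0, ht1⟩ with hu₀_def
  have hu₀pc : ((u₀ : unitInterval) : ℝ) < pc := htpc
  obtain ⟨C₀, c₀, hc₀, hT⟩ := hT u₀ hu₀pc
  -- `C₀ ≥ 0` (the bound at `n = 0` dominates a probability)
  have hC₀ : 0 ≤ C₀ := by
    have h := hT 0
    have h0 : (0 : ℝ) ≤ (bondPercolation (zdGraph 3) u₀).real
        {ω | ((0 : ℕ) : ℕ∞) ≤ (openCluster ω 0).encard} := MeasureTheory.measureReal_nonneg
    have : C₀ * Real.exp (-(c₀ * (0 : ℕ))) = C₀ := by simp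
    linarith [this ▸ h0.trans h]
  refine ⟨Δ₀, max (max C C₀) 0, min c c₀, hΔ₀, hΔ₁, lt_min hc hc₀, fun u hu n => ?_⟩
  have hC'0 : 0 ≤ max (max C C₀) 0 := le_max_right _ _
  have hCC' : C ≤ max (max C C₀) 0 := (le_max_left _ _).trans (le_max_left _ _)
  have hC₀C' : C₀ ≤ max (max C C₀) 0 := (le_max_right _ _).trans (le_max_left _ _)
  have hs0 : 0 < pc - (u : ℝ) := sub_pos.2 hu
  have hs1 : pc - (u : ℝ) ≤ 1 := by linarith [u.2.1, hpc.2]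
  have hsΔ0 : 0 ≤ (pc - (u : ℝ)) ^ Δ₀ := Real.rpow_nonneg hs0.le _
  have hsΔ1 : (pc - (u : ℝ)) ^ Δ₀ ≤ 1 := Real.rpow_le_one hs0.le hs1 hΔ₀.le
  have hn0 : (0 : ℝ) ≤ n := Nat.cast_nonneg n
  by_cases hut : (u : ℝ) ≤ t
  · -- deep levels: monotonicity to `u₀`, the tail there, and `s^{Δ₀} ≤ 1`
    have hle : u ≤ u₀ := Subtype.coe_le_coe.1 hut
    have h1 := hM u u₀ hle n
    have h2 := hT n
    have h3 : Real.exp (-(c₀ * n)) ≤ Real.exp (-(min c c₀ * n * (pc - (u : ℝ)) ^ Δ₀)) := by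
      apply Real.exp_le_exp.2
      have : min c c₀ * n * (pc - (u : ℝ)) ^ Δ₀ ≤ c₀ * n * 1 :=
        mul_le_mul (mul_le_mul_of_nonneg_right (min_le_right _ _) hn0) hsΔ1 hsΔ0
          (mul_nonneg hc₀.le hn0)
      linarith
    calc _ ≤ _ := h1
      _ ≤ C₀ * Real.exp (-(c₀ * n)) := h2
      _ ≤ C₀ * Real.exp (-(min c c₀ * n * (pc - (u : ℝ)) ^ Δ₀)) :=
          mul_le_mul_of_nonneg_left h3 hC₀
      _ ≤ max (max C C₀) 0 * Real.exp (-(min c c₀ * n * (pc - (u : ℝ)) ^ Δ₀)) :=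
          mul_le_mul_of_nonneg_right hC₀C' (Real.exp_pos _).le
  · -- near levels: `pc - ε₀ < pc - ε₀/2 ≤ t < u`
    have hnear : pc - ε₀ < (u : ℝ) := by
      have : pc - ε₀ / 2 ≤ t := le_max_left _ _
      linarith [not_le.1 hut]
    have h1 := hN u hnear hu n
    have h3 : Real.exp (-(c * n * (pc - (u : ℝ)) ^ Δ₀)) ≤
        Real.exp (-(min c c₀ * n * (pc - (u : ℝ)) ^ Δ₀)) := by
      apply Real.exp_le_exp.2
      have : min c c₀ * n * (pc - (u : ℝ)) ^ Δ₀ ≤ c * n * (pc - (u : ℝ)) ^ Δ₀ :=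
        mul_le_mul_of_nonneg_right (mul_le_mul_of_nonneg_right (min_le_left _ _) hn0) hsΔ0
      linarith
    calc _ ≤ C * Real.exp (-(c * n * (pc - (u : ℝ)) ^ Δ₀)) := h1
      _ ≤ max (max C C₀) 0 * Real.exp (-(c * n * (pc - (u : ℝ)) ^ Δ₀)) :=
          mul_le_mul_of_nonneg_right hCC' (Real.exp_pos _).le
      _ ≤ max (max C C₀) 0 * Real.exp (-(min c c₀ * n * (pc - (u : ℝ)) ^ Δ₀)) :=
          mul_le_mul_of_nonneg_left h3 hC'0

/-- **The rev-3b stub `stub_gapWindow`, now DERIVED** (statement byte-identical to rev 3b): the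
subcritical volume window with gap exponent `Δ₀ < 5/2` on all levels `u < p_c`, from the three
registered (b)-stubs by `gapWindow_of`.  Its only `sorry`s are theirs. -/
theorem stub_gapWindow :
    ∃ Δ₀ C c : ℝ, 0 < Δ₀ ∧ Δ₀ < 5 / 2 ∧ 0 < c ∧
      ∀ u : unitInterval, (u : ℝ) < criticalProb (zdGraph 3) 0 → ∀ n : ℕ,
        (bondPercolation (zdGraph 3) u).real {ω | (n : ℕ∞) ≤ (openCluster ω 0).encard} ≤
          C * Real.exp (-(c * n * (criticalProb (zdGraph 3) 0 - u) ^ Δ₀)) :=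
  gapWindow_of stub_gapWindowNear stub_subcritVolumeTail stub_volumeTail_mono

/-- **The two engines give the BODY of the crux** (the rev-3b composition, conclusion spelled out so
that the first theorem concluding the crux by name is the four-stub composition `TwoArmWindow_of`
below): engine (a) = the landed small-level piece + the open core `Sig.stub_volumeTwoArmCore`; engine
(b) = `Sig.stub_gapWindow`; common constant `C := max (max (max C₁ C₂) C₃) 0`, `n^{−1} ≤ n^{−λ}` for
`n ≥ 1`, budget `Δ₀(1−λ) ≤ Δ₀·(2/5) < 1`. -/
theorem twoArmWindow_body_of_engines (ha : Sig.stub_volumeTwoArmCore) (hb : Sig.stub_gapWindow) :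
    ∃ lam Δ₀ C c : ℝ, 0 ≤ lam ∧ lam < 1 ∧ 0 < Δ₀ ∧ Δ₀ * (1 - lam) < 1 ∧ 0 < c ∧
      (∀ u : unitInterval, (u : ℝ) < criticalProb (zdGraph 3) 0 → ∀ n : ℕ, 1 ≤ n →
        ∑ y ∈ (zdGraph 3).neighborFinset (0 : Site 3),
          (bondPercolation (zdGraph 3) u).real
            {ω | (n : ℕ∞) ≤ (openCluster ω 0).encard ∧ (n : ℕ∞) ≤ (openCluster ω y).encard ∧
              ¬ (openGraph ω).Reachable 0 y} ≤ C * (n : ℝ) ^ (-lam)) ∧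
      (∀ u : unitInterval, (u : ℝ) < criticalProb (zdGraph 3) 0 → ∀ n : ℕ,
        (bondPercolation (zdGraph 3) u).real {ω | (n : ℕ∞) ≤ (openCluster ω 0).encard} ≤
          C * Real.exp (-(c * n * (criticalProb (zdGraph 3) 0 - u) ^ Δ₀))) := by
  obtain ⟨C₁, h₀⟩ := stub_twoArmSmallLevel
  obtain ⟨lam, C₂, hlam, hlam1, ha⟩ := ha
  obtain ⟨Δ₀, C₃, c, hΔ₀, hΔ₁, hc, hb⟩ := hb
  set C : ℝ := max (max (max C₁ C₂) C₃) 0 with hCdef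
  have hC0 : 0 ≤ C := le_max_right _ _
  have hC1 : C₁ ≤ C := ((le_max_left C₁ C₂).trans (le_max_left _ C₃)).trans (le_max_left _ _)
  have hC2 : C₂ ≤ C := ((le_max_right C₁ C₂).trans (le_max_left _ C₃)).trans (le_max_left _ _)
  have hC3 : C₃ ≤ C := (le_max_right (max C₁ C₂) C₃).trans (le_max_left _ _)
  refine ⟨lam, Δ₀, C, c, by linarith, hlam1, hΔ₀, ?_, hc, ?_, ?_⟩
  · -- exponent budget: `Δ₀ (1 - λ) ≤ Δ₀ · (2/5) < (5/2) · (2/5) = 1`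
    have h1 : 1 - lam ≤ 2 / 5 := by linarith
    have h2 : Δ₀ * (1 - lam) ≤ Δ₀ * (2 / 5) := mul_le_mul_of_nonneg_left h1 hΔ₀.le
    linarith
  · -- engine (a): small levels by `h₀` (exponent `1 ≥ λ`), the core by `ha`
    intro u hu n hn
    have hn' : (1 : ℝ) ≤ (n : ℝ) := by exact_mod_cast hn
    by_cases hsmall : (u : ℝ) ≤ 1 / 5
    · calc _ ≤ C₁ * (n : ℝ) ^ (-(1 : ℝ)) := h₀ u hsmall n hn
        _ ≤ C * (n : ℝ) ^ (-(1 : ℝ)) :=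
            mul_le_mul_of_nonneg_right hC1 (Real.rpow_nonneg (Nat.cast_nonneg n) _)
        _ ≤ C * (n : ℝ) ^ (-lam) :=
            mul_le_mul_of_nonneg_left
              (Real.rpow_le_rpow_of_exponent_le hn' (by linarith)) hC0
    · exact (ha u (not_le.mp hsmall) hu n hn).trans
        (mul_le_mul_of_nonneg_right hC2 (Real.rpow_nonneg (Nat.cast_nonneg n) _))
  · -- engine (b) with the common constant
    intro u hu n
    exact (hb u hu n).trans (mul_le_mul_of_nonneg_right hC3 (Real.exp_pos _).le)

/-- **THE SKELETON (rev 4b): the crux from its two OPEN CORES** (kernel-checked, no `sorry` of its own):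
`stub_volumeTwoArmCore` (engine (a): p-uniform two-arm exponent `λ ≥ 3/5`) and `stub_gapWindowNear`
(engine (b): near-critical volume window `Δ₀ < 5/2`) ⇒ `PercMinContact.TwoArmWindow` BY NAME — engine (b)
is completed below `p_c − ε₀/2` by the LANDED exponential subcritical volume tail and monotone coupling
(`gapWindow_of`), engine (a) below `1/5` by the LANDED small-level piece (`twoArmWindow_body_of_engines`). -/
theorem TwoArmWindow_of (ha : Sig.stub_volumeTwoArmCore) (hN : Sig.stub_gapWindowNear) :
    Summit.CriticalPhenomena.PercolationContinuityZ3.Theses.PercMinContact.TwoArmWindow := by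
  unfold Summit.CriticalPhenomena.PercolationContinuityZ3.Theses.PercMinContact.TwoArmWindow
  -- the two KNOWN (b)-pieces are no longer hypotheses: they are the LANDED theorems (p151244, p149565)
  exact twoArmWindow_body_of_engines ha (gapWindow_of hN stub_subcritVolumeTail stub_volumeTail_mono)

/- The rev-3b two-engine form `Sig.stub_volumeTwoArmCore → Sig.stub_gapWindow → TwoArmWindow` is
`by unfold …TwoArmWindow; exact twoArmWindow_body_of_engines ha hb`; it is not declared as a theorem so
that exactly ONE declaration of this file concludes the crux by name (the skeleton checker's rule). -/
example (ha : Sig.stub_volumeTwoArmCore) (hb : Sig.stub_gapWindow) :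
    Summit.CriticalPhenomena.PercolationContinuityZ3.Theses.PercMinContact.TwoArmWindow := by
  unfold Summit.CriticalPhenomena.PercolationContinuityZ3.Theses.PercMinContact.TwoArmWindow
  exact twoArmWindow_body_of_engines ha hb

/-! ## §3 Definitional consistency: the registered stubs feed the compositions verbatim -/

/-- The registered stub (a₀), as spelled out, IS the name-keyed statement `Sig.stub_twoArmSmallLevel`. -/
theorem twoArmSmallLevel_registered : Sig.stub_twoArmSmallLevel := stub_twoArmSmallLevel

/-- The registered stub (a) core, as spelled out, IS the name-keyed statement `Sig.stub_volumeTwoArmCore`. -/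
theorem volumeTwoArmCore_registered : Sig.stub_volumeTwoArmCore := stub_volumeTwoArmCore

/-- The registered stub (b) core, as spelled out, IS the name-keyed statement `Sig.stub_gapWindowNear`. -/
theorem gapWindowNear_registered : Sig.stub_gapWindowNear := stub_gapWindowNear

/-- The registered stub (b₁), as spelled out, IS the name-keyed statement `Sig.stub_subcritVolumeTail`. -/
theorem subcritVolumeTail_registered : Sig.stub_subcritVolumeTail := stub_subcritVolumeTail

/-- The registered stub (b₂), as spelled out, IS the name-keyed statement `Sig.stub_volumeTail_mono`. -/
theorem volumeTail_mono_registered : Sig.stub_volumeTail_mono := stub_volumeTail_mono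

/-- The derived rev-3b statement (b), as spelled out, IS the name-keyed statement `Sig.stub_gapWindow`. -/
theorem gapWindow_registered : Sig.stub_gapWindow := stub_gapWindow

/-- **What is PROVED of the open core (a): `λ = 1/2`** (LANDED as `Theorems.twoArm_half`, p145214):
for every level `u > 1/5` and every `n ≥ 1`,
`Σ_{y ∼ 0} P_u(|C(0)| ≥ n ∧ |C(y)| ≥ n ∧ 0 ↮ y) ≤ C · n^{−1/2}` (two-ghost inequality,
arXiv:1808.08940 Cor. 1.7, + a.s. uniqueness of the infinite cluster). -/
theorem volumeTwoArmCore_half :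
    ∃ C : ℝ, ∀ u : unitInterval, 1 / 5 < (u : ℝ) → ∀ n : ℕ, 1 ≤ n →
      ∑ y ∈ (zdGraph 3).neighborFinset (0 : Site 3),
        (bondPercolation (zdGraph 3) u).real
          {ω | (n : ℕ∞) ≤ (openCluster ω 0).encard ∧ (n : ℕ∞) ≤ (openCluster ω y).encard ∧
            ¬ (openGraph ω).Reachable 0 y} ≤ C * (n : ℝ) ^ (-(1 / 2 : ℝ)) :=
  Summit.CriticalPhenomena.PercolationContinuityZ3.Theorems.twoArm_half

/-- **Rigorous status of clause (a) of the crux: `λ = 1/2` at EVERY level** (LANDED as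
`Theorems.twoArm_clauseA_half`, p146583). -/
theorem clauseA_half :
    ∃ C : ℝ, ∀ u : unitInterval, ∀ n : ℕ, 1 ≤ n →
      ∑ y ∈ (zdGraph 3).neighborFinset (0 : Site 3),
        (bondPercolation (zdGraph 3) u).real
          {ω | (n : ℕ∞) ≤ (openCluster ω 0).encard ∧ (n : ℕ∞) ≤ (openCluster ω y).encard ∧
            ¬ (openGraph ω).Reachable 0 y} ≤ C * (n : ℝ) ^ (-(1 / 2 : ℝ)) :=
  Summit.CriticalPhenomena.PercolationContinuityZ3.Theorems.twoArm_clauseA_half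

/-- **Budget tightness, LANDED (p150861): any near-critical volume window has `Δ₀ ≥ 1`** — so the
corner `λ = 0` of the crux is empty and every witness has `λ > 0` (layer cake + Aizenman–Newman
`χ ≥ 1/(6(p_c−u))`, `AizenmanNewman1984_chi_lower_holds`).  Record of `Theorems.twoArmWindow_gap_ge_one`. -/
theorem gapWindowNear_gap_ge_one :
    ∀ Δ₀ C c ε₀ : ℝ, 0 < Δ₀ → 0 < c → 0 < ε₀ →
      (∀ u : unitInterval, criticalProb (zdGraph 3) 0 - ε₀ < (u : ℝ) →
        (u : ℝ) < criticalProb (zdGraph 3) 0 → ∀ n : ℕ,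
          (bondPercolation (zdGraph 3) u).real {ω | (n : ℕ∞) ≤ (openCluster ω 0).encard} ≤
            C * Real.exp (-(c * n * (criticalProb (zdGraph 3) 0 - u) ^ Δ₀))) →
      1 ≤ Δ₀ :=
  Summit.CriticalPhenomena.PercolationContinuityZ3.Theorems.twoArmWindow_gap_ge_one

/-- **Budget tightness, LANDED (p150861): a near-critical volume window with `Δ₀ < 2` is
summit-strength** — it proves `PercolationContinuityZ3` outright (layer cake + the in-tree Hutchcroft–Newman
criterion `percolationContinuity_of_sq_mul_expClusterSize`).  This is why the line's informative cell is
`Δ₀ ∈ [2, 5/2)` and why the KNOWN `λ = 1/2` allocation (which needs `Δ₀ < 2`) is not a line.  Record of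
`Theorems.percolationContinuityZ3_of_gapWindow_lt_two`. -/
theorem gapWindowNear_lt_two_summit :
    ∀ Δ₀ C c ε₀ : ℝ, 0 < Δ₀ → Δ₀ < 2 → 0 < c → 0 < ε₀ →
      (∀ u : unitInterval, criticalProb (zdGraph 3) 0 - ε₀ < (u : ℝ) →
        (u : ℝ) < criticalProb (zdGraph 3) 0 → ∀ n : ℕ,
          (bondPercolation (zdGraph 3) u).real {ω | (n : ℕ∞) ≤ (openCluster ω 0).encard} ≤
            C * Real.exp (-(c * n * (criticalProb (zdGraph 3) 0 - u) ^ Δ₀))) →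
      _root_.PercolationContinuityZ3 :=
  Summit.CriticalPhenomena.PercolationContinuityZ3.Theorems.percolationContinuityZ3_of_gapWindow_lt_two

/- The crux from the four registered stubs (an `example`, so no `sorry`-tainted proof of the crux
enters the environment). -/
example : Summit.CriticalPhenomena.PercolationContinuityZ3.Theses.PercMinContact.TwoArmWindow :=
  TwoArmWindow_of stub_volumeTwoArmCore stub_gapWindowNear

end Summit.CriticalPhenomena.PercolationContinuityZ3.Cruxes.TwoArmWindow.Birth
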